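import Summits.CriticalPhenomena.PercolationContinuityZ3.Theorems.PercNonProliferationFreeBoxSparseStubCollarClass
import HarnessLib

/-!
# Crux `PercNonProliferation.FreeBoxSparse` (stmt-CriticalPhenomena-4445), line `ccfs-window-kissing-walls` —
# stub `stub_collar` (K2 = COLLAR RARITY)

Proves the registered stub `stub_collar` of the lead's skeleton of line `ccfs-window-kissing-walls`
(prover-line-stmt-CriticalPhenomena-4445-0) verbatim; lands with `--supports stmt-CriticalPhenomena-4445`.

Statement: for `p ∈ (0,1)`, `δ, σ > 0`, `r ∈ ℕ` there is `C` such that for EVERY finite `Λ ⊂ ℤ³`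
the event "some `x, y ∈ Λ` carry free pieces of `≥ δ|Λ|` vertices, not joined inside `Λ`, whose
`r`-contact volume (number of centres `a ∈ Λ` of interior balls `B_r(a) ⊆ Λ` met by both pieces) is
`≥ |Λ|^{1/2+σ}`" has `P_p`-probability `≤ C |Λ|^{−σ/2}`.

Proof (helper files `…StubCollarChiSq/Sprinkle/Merge/Geom/Residues/Window/Bridge/Class`):
pigeonhole the doubly-met centres over the `(2r+1)³` residue classes `mod 2r+1`
(`stub_collar_residues`): on the event some class `ρ` carries `≥ |Λ|^{1/2+σ}/(2r+1)³` of them, i.e.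
the event lies in the union over `ρ` of the per-class collar events, each of probability
`≤ C₁|Λ|^{−σ/2}` (`stub_collar_class`: template sprinkling of the balls of class `ρ` — tiles of ONE
tiling — raising the free volume functional, the sprinkling window, and the
Chayes–Chayes–Fisher–Spencer total-variation window back to `P_p`); `C = (2r+1)³ C₁`. The empty `Λ`
gives `0 ≤ C · 0`.
-/

noncomputable section

namespace Summit.CriticalPhenomena.PercolationContinuityZ3.Theorems.FreeBoxSparse

open MeasureTheory Filter
open Literature.Probability.Percolation Literature.Probability.LatticeModels
open scoped Topology Classical

/-- **`stub_collar` (K2 = COLLAR RARITY — the Chayes–Chayes–Fisher–Spencer window lever).** For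
`δ, σ > 0` and `r ∈ ℕ` there is `C = C(p, δ, σ, r)` such that for every finite `Λ ⊂ ℤ³`: the event
"there are `x, y ∈ Λ`, both with free pieces of `≥ δ|Λ|` vertices, NOT joined inside `Λ`, whose
`r`-contact volume — the number of centres `a ∈ Λ` with `B_r(a) ⊆ Λ` such that both pieces come
within sup-distance `r` of `a` — is at least `|Λ|^{1/2+σ}`" has `P_p`-probability `≤ C |Λ|^{−σ/2}`,
uniformly in `Λ`: two distinct free-boundary giants cannot be collared-close along more than
`|Λ|^{1/2+σ}` balls. [cite: ChayesEtAl1986, finite-size scaling window]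
[cite: AizenmanKestenNewmanCMP1987, uniqueness via the square-root law]
[cite: Cerf2015, Lemma 5.1 and Prop. 5.2] -/
theorem stub_collar :
    ∀ (p : unitInterval), 0 < (p : ℝ) → (p : ℝ) < 1 → ∀ δ σ : ℝ, 0 < δ → 0 < σ → ∀ r : ℕ, ∃ C : ℝ,
      ∀ Λ : Finset (Site 3),
        (bondPercolation (zdGraph 3) p).real
          {ω | ∃ x ∈ Λ, ∃ y ∈ Λ, δ * (Λ.card : ℝ) ≤ (((Λ.filter fun v => ω ∈ openConnIn ↑Λ x v)).card : ℝ) ∧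
            δ * (Λ.card : ℝ) ≤ (((Λ.filter fun v => ω ∈ openConnIn ↑Λ y v)).card : ℝ) ∧
            ω ∉ openConnIn ↑Λ x y ∧
            ((Λ.card : ℝ)) ^ ((1 : ℝ) / 2 + σ) ≤
              (Set.ncard {a : Site 3 | a ∈ Λ ∧ (box 3 r).image (· + a) ⊆ Λ ∧ (∃ u ∈ Λ, (Finset.univ.sup fun j : Fin 3 => (u j - a j).natAbs) ≤ r ∧ ω ∈ openConnIn ↑Λ x u) ∧ (∃ u ∈ Λ, (Finset.univ.sup fun j : Fin 3 => (u j - a j).natAbs) ≤ r ∧ ω ∈ openConnIn ↑Λ y u)} : ℝ)}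
        ≤ C * ((Λ.card : ℝ)) ^ (-(σ / 2)) := by
  intro p hp0 hp1 δ σ hδ hσ r
  refine ⟨(2 * r + 1) ^ 3 * ((2 * δ ^ 2)⁻¹ + Real.sqrt (2 * (2 * r + 1) ^ 6 * ((p : ℝ) ^ Nat.choose ((2 * r + 1) ^ 3 + 1) 2)⁻¹) + (2 * r + 1) ^ 3 + (2 * r + 1) ^ 6 * ((p : ℝ) ^ Nat.choose ((2 * r + 1) ^ 3 + 1) 2)⁻¹), ?_⟩
  intro Λ
  rcases Λ.eq_empty_or_nonempty with hΛ | hΛ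
  · -- empty `Λ`: both sides vanish
    subst hΛ
    rw [Finset.card_empty, Nat.cast_zero, Real.zero_rpow (by linarith : (-(σ / 2) : ℝ) ≠ 0)]
    simp only [mul_zero]
    refine le_of_eq ?_
    convert measureReal_empty (μ := bondPercolation (zdGraph 3) p)
    ext ω
    simp
  -- pigeonhole over the residue classes, then collar rarity class by class
  have hclass := fun ρ => stub_collar_class p hp0 δ σ hδ hσ r Λ ρ hΛ
  have hsub : {ω | ∃ x ∈ Λ, ∃ y ∈ Λ, δ * (Λ.card : ℝ) ≤ (((Λ.filter fun v => ω ∈ openConnIn ↑Λ x v)).card : ℝ) ∧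
            δ * (Λ.card : ℝ) ≤ (((Λ.filter fun v => ω ∈ openConnIn ↑Λ y v)).card : ℝ) ∧
            ω ∉ openConnIn ↑Λ x y ∧
            ((Λ.card : ℝ)) ^ ((1 : ℝ) / 2 + σ) ≤
              (Set.ncard {a : Site 3 | a ∈ Λ ∧ (box 3 r).image (· + a) ⊆ Λ ∧ (∃ u ∈ Λ, (Finset.univ.sup fun j : Fin 3 => (u j - a j).natAbs) ≤ r ∧ ω ∈ openConnIn ↑Λ x u) ∧ (∃ u ∈ Λ, (Finset.univ.sup fun j : Fin 3 => (u j - a j).natAbs) ≤ r ∧ ω ∈ openConnIn ↑Λ y u)} : ℝ)} ⊆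
      ⋃ ρ ∈ Fintype.piFinset (fun _ : Fin 3 => Finset.Ico (0 : ℤ) (2 * (r : ℤ) + 1)), {ω | ∃ x ∈ Λ, ∃ y ∈ Λ, δ * (Λ.card : ℝ) ≤ (((Λ.filter fun v => ω ∈ openConnIn ↑Λ x v)).card : ℝ) ∧ δ * (Λ.card : ℝ) ≤ (((Λ.filter fun v => ω ∈ openConnIn ↑Λ y v)).card : ℝ) ∧ ω ∉ openConnIn ↑Λ x y ∧ ((Λ.card : ℝ)) ^ ((1 : ℝ) / 2 + σ) ≤ (2 * r + 1) ^ 3 * ((Λ.filter fun a => ((box 3 r).image (· + a) ⊆ Λ ∧ (∃ u ∈ Λ, (Finset.univ.sup fun j : Fin 3 => (u j - a j).natAbs) ≤ r ∧ ω ∈ openConnIn ↑Λ x u) ∧ (∃ u ∈ Λ, (Finset.univ.sup fun j : Fin 3 => (u j - a j).natAbs) ≤ r ∧ ω ∈ openConnIn ↑Λ y u)) ∧ (fun j => a j % (2 * (r : ℤ) + 1)) = ρ).card : ℝ)} := by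
    intro ω hω
    rw [Set.mem_setOf_eq] at hω
    obtain ⟨x, hx, y, hy, h1, h2, h3, hV⟩ := hω
    have hset : {a : Site 3 | a ∈ Λ ∧ (box 3 r).image (· + a) ⊆ Λ ∧ (∃ u ∈ Λ, (Finset.univ.sup fun j : Fin 3 => (u j - a j).natAbs) ≤ r ∧ ω ∈ openConnIn ↑Λ x u) ∧ (∃ u ∈ Λ, (Finset.univ.sup fun j : Fin 3 => (u j - a j).natAbs) ≤ r ∧ ω ∈ openConnIn ↑Λ y u)} = ↑(Λ.filter fun a => (box 3 r).image (· + a) ⊆ Λ ∧ (∃ u ∈ Λ, (Finset.univ.sup fun j : Fin 3 => (u j - a j).natAbs) ≤ r ∧ ω ∈ openConnIn ↑Λ x u) ∧ (∃ u ∈ Λ, (Finset.univ.sup fun j : Fin 3 => (u j - a j).natAbs) ≤ r ∧ ω ∈ openConnIn ↑Λ y u)) := by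
      ext a
      rw [Finset.mem_coe, Finset.mem_filter]
      rfl
    rw [hset, Set.ncard_coe_finset] at hV
    obtain ⟨ρ, hρR, hρ⟩ := stub_collar_residues r (Λ.filter fun a => (box 3 r).image (· + a) ⊆ Λ ∧ (∃ u ∈ Λ, (Finset.univ.sup fun j : Fin 3 => (u j - a j).natAbs) ≤ r ∧ ω ∈ openConnIn ↑Λ x u) ∧ (∃ u ∈ Λ, (Finset.univ.sup fun j : Fin 3 => (u j - a j).natAbs) ≤ r ∧ ω ∈ openConnIn ↑Λ y u))
    rw [Finset.filter_filter] at hρ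
    refine Set.mem_iUnion₂.2 ⟨ρ, hρR, ?_⟩
    rw [Set.mem_setOf_eq]
    refine ⟨x, hx, y, hy, h1, h2, h3, hV.trans ?_⟩
    exact_mod_cast hρ
  calc (bondPercolation (zdGraph 3) p).real {ω | ∃ x ∈ Λ, ∃ y ∈ Λ, δ * (Λ.card : ℝ) ≤ (((Λ.filter fun v => ω ∈ openConnIn ↑Λ x v)).card : ℝ) ∧
            δ * (Λ.card : ℝ) ≤ (((Λ.filter fun v => ω ∈ openConnIn ↑Λ y v)).card : ℝ) ∧
            ω ∉ openConnIn ↑Λ x y ∧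
            ((Λ.card : ℝ)) ^ ((1 : ℝ) / 2 + σ) ≤
              (Set.ncard {a : Site 3 | a ∈ Λ ∧ (box 3 r).image (· + a) ⊆ Λ ∧ (∃ u ∈ Λ, (Finset.univ.sup fun j : Fin 3 => (u j - a j).natAbs) ≤ r ∧ ω ∈ openConnIn ↑Λ x u) ∧ (∃ u ∈ Λ, (Finset.univ.sup fun j : Fin 3 => (u j - a j).natAbs) ≤ r ∧ ω ∈ openConnIn ↑Λ y u)} : ℝ)}
      ≤ (bondPercolation (zdGraph 3) p).real
          (⋃ ρ ∈ Fintype.piFinset (fun _ : Fin 3 => Finset.Ico (0 : ℤ) (2 * (r : ℤ) + 1)), {ω | ∃ x ∈ Λ, ∃ y ∈ Λ, δ * (Λ.card : ℝ) ≤ (((Λ.filter fun v => ω ∈ openConnIn ↑Λ x v)).card : ℝ) ∧ δ * (Λ.card : ℝ) ≤ (((Λ.filter fun v => ω ∈ openConnIn ↑Λ y v)).card : ℝ) ∧ ω ∉ openConnIn ↑Λ x y ∧ ((Λ.card : ℝ)) ^ ((1 : ℝ) / 2 + σ) ≤ (2 * r + 1) ^ 3 * ((Λ.filter fun a => ((box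 3 r).image (· + a) ⊆ Λ ∧ (∃ u ∈ Λ, (Finset.univ.sup fun j : Fin 3 => (u j - a j).natAbs) ≤ r ∧ ω ∈ openConnIn ↑Λ x u) ∧ (∃ u ∈ Λ, (Finset.univ.sup fun j : Fin 3 => (u j - a j).natAbs) ≤ r ∧ ω ∈ openConnIn ↑Λ y u)) ∧ (fun j => a j % (2 * (r : ℤ) + 1)) = ρ).card : ℝ)}) :=
        measureReal_mono hsub (measure_ne_top _ _)
    _ ≤ ∑ ρ ∈ Fintype.piFinset (fun _ : Fin 3 => Finset.Ico (0 : ℤ) (2 * (r : ℤ) + 1)),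
          (bondPercolation (zdGraph 3) p).real {ω | ∃ x ∈ Λ, ∃ y ∈ Λ, δ * (Λ.card : ℝ) ≤ (((Λ.filter fun v => ω ∈ openConnIn ↑Λ x v)).card : ℝ) ∧ δ * (Λ.card : ℝ) ≤ (((Λ.filter fun v => ω ∈ openConnIn ↑Λ y v)).card : ℝ) ∧ ω ∉ openConnIn ↑Λ x y ∧ ((Λ.card : ℝ)) ^ ((1 : ℝ) / 2 + σ) ≤ (2 * r + 1) ^ 3 * ((Λ.filter fun a => ((box 3 r).image (· + a) ⊆ Λ ∧ (∃ u ∈ Λ, (Finset.univ.sup fun j : Fin 3 => (u j - a j).natAbs) ≤ r ∧ ω ∈ openConnIn ↑Λ x u) ∧ (∃ u ∈ Λ, (Finset.univ.sup fun j : Fin 3 => (u j - a j).natAbs) ≤ r ∧ ω ∈ openConnIn ↑Λ y u)) ∧ (fun j => a j % (2 * (r : ℤ) + 1)) = ρ).card : ℝ)} := measureReal_biUnion_finset_le _ _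
    _ ≤ ∑ _ρ ∈ Fintype.piFinset (fun _ : Fin 3 => Finset.Ico (0 : ℤ) (2 * (r : ℤ) + 1)),
          ((2 * δ ^ 2)⁻¹ + Real.sqrt (2 * (2 * r + 1) ^ 6 * ((p : ℝ) ^ Nat.choose ((2 * r + 1) ^ 3 + 1) 2)⁻¹) + (2 * r + 1) ^ 3 + (2 * r + 1) ^ 6 * ((p : ℝ) ^ Nat.choose ((2 * r + 1) ^ 3 + 1) 2)⁻¹) * ((Λ.card : ℝ)) ^ (-(σ / 2)) := Finset.sum_le_sum fun ρ _ => hclass ρ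
    _ = (2 * r + 1) ^ 3 * ((2 * δ ^ 2)⁻¹ + Real.sqrt (2 * (2 * r + 1) ^ 6 * ((p : ℝ) ^ Nat.choose ((2 * r + 1) ^ 3 + 1) 2)⁻¹) + (2 * r + 1) ^ 3 + (2 * r + 1) ^ 6 * ((p : ℝ) ^ Nat.choose ((2 * r + 1) ^ 3 + 1) 2)⁻¹) * ((Λ.card : ℝ)) ^ (-(σ / 2)) := by
        rw [Finset.sum_const, StubCollar.card_residues, nsmul_eq_mul]
        push_cast
        ring

end Summit.CriticalPhenomena.PercolationContinuityZ3.Theorems.FreeBoxSparse
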